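import Summits.Ventures.PercRepro.SixThreeSeam
import Summits.Ventures.PercRepro.SixThreeStep5
import Summits.Ventures.PercRepro.SixThreeClassify

/-!
# PercRepro — discharging the (6,3) table hypotheses from p3's table rows (p2, gen 6)

`SixThreeCompose.lean` proves C-025 at `(6, 3)` modulo Theorem P₁ (p5) and three table hypotheses on every plane
`G` with `5 ≤ g` points of a simple coloop-free core: `TableIneqAdd12 g (prof G)` (types `1`, `2`), the general
type-`3` row and the two-line type-`3` row.  p3's `SixThreeTable.lean` / `SixThreeStep5.lean` prove the numeric rows
`0 ≤ Δ_t(g, prof) − correction` for every `g ≥ 4` on the five plane shapes (general short / long, line + point,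
two lines meeting / disjoint); `SixThreeSeam.lean` identifies `Table.F`, `Table.N3cnt`, `Table.C2` with
`FsumAdd`, `N3`, `C2gen` on a real plane.  This file puts the two together: the realisability package of a real
plane, the shape lemmas `Δ ≥ c` from p3's rows, and the three discharges `tableIneqAdd12_of_plane`,
`type3_general_of_plane`, `type3_twoLines_of_plane`.
-/

namespace PercRepro

namespace SixThree

open Finset ThmH

variable {α : Type*} [DecidableEq α] {M : Matroid α} [M.Finite]

/-! ### The realisability package of a real plane -/

/-- `Σ_{m ∈ prof} C(m, s) ≤ C(g, s)` for `s ≥ 3` (the `s`-subsets of the lines are rank-`2` `s`-subsets of `G`). -/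
theorem prof_choose_le (hs : Simple M) {G : Finset α} (hG : G ∈ planes M) {s : ℕ} (hs3 : 3 ≤ s) :
    (Multiset.map (fun m => m.choose s) (prof M G)).sum ≤ G.card.choose s := by
  have hGg : G ⊆ gr M := (mem_planes.1 hG).1
  have h := card_rank_three_subsets_add hs hGg (mem_planes.1 hG).2.2 (s := s) (by omega)
  have hp := sum_prof_eq (M := M) G (fun m => m.choose s) (Nat.choose_eq_zero_of_lt (by omega))
  rw [hp]
  omega

/-- `lp_s ≤ N_s` for `s ≥ 4` (the line + point `s`-sets are rank-`3` `s`-subsets). -/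
theorem lps_le_Ns (hs : Simple M) {G : Finset α} (hG : G ∈ planes M) {s : ℕ} (hs4 : 4 ≤ s) :
    lps G.card (prof M G) s ≤ Ns G.card (prof M G) s := by
  rw [← card_R3s_lp hs hG hs4, ← card_R3s hs hG (by omega)]
  exact Finset.card_filter_le _ _

/-- Every profile entry satisfies `3 ≤ m ≤ g`. -/
theorem prof_mem_le {G : Finset α} (hG : G ∈ planes M) {m : ℕ} (hm : m ∈ prof M G) : 3 ≤ m ∧ m ≤ G.card := by
  have h := prof_mem_bounds hG hm
  omega

/-- Membership in a list representing the profile. -/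
theorem mem_prof_of_mem_list {G : Finset α} {l : List ℕ} (hl : (l : Multiset ℕ) = prof M G) {m : ℕ}
    (hm : m ∈ l) : m ∈ prof M G := by
  rw [← hl]
  exact Multiset.mem_coe.2 hm

/-- **`Table.F t g l = FsumAdd (6 − t) g (prof G)`** on a real plane, for any list `l` representing the profile. -/
theorem F_eq_of_plane (hs : Simple M) {G : Finset α} (hG : G ∈ planes M) {t : ℕ} (ht : t = 1 ∨ t = 2 ∨ t = 3)
    {l : List ℕ} (hl : (l : Multiset ℕ) = prof M G) :
    Table.F t G.card l = FsumAdd (6 - t) G.card (prof M G) := by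
  rw [← hl]
  refine F_eq_FsumAdd ht (fun m hm => prof_mem_le hG (mem_prof_of_mem_list hl hm)) ?_ ?_ ?_ ?_
  · intro s hs3; rw [hl]; exact prof_choose_le hs hG hs3
  · rw [hl]; exact lps_le_Ns hs hG (by norm_num)
  · rw [hl]; exact lps_le_Ns hs hG (by norm_num)
  · intro s hs6; rw [hl]; exact sum_line_plus_two_add_lps_le hs hG hs6

/-- `Table.N3cnt g l = N₃(g, prof G)`. -/
theorem N3_eq_of_plane (hs : Simple M) {G : Finset α} (hG : G ∈ planes M) {l : List ℕ}
    (hl : (l : Multiset ℕ) = prof M G) :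
    ((N3 G.card (prof M G) : ℕ) : ℚ) = Table.N3cnt G.card l := by
  rw [← hl]
  exact N3_cast (fun m hm => prof_mem_le hG (mem_prof_of_mem_list hl hm))
    (fun s hs3 => by rw [hl]; exact prof_choose_le hs hG hs3)

/-- `Table.C2 g l = C2gen(g, prof G)`. -/
theorem C2gen_eq_of_plane (hs : Simple M) {G : Finset α} (hG : G ∈ planes M) {l : List ℕ}
    (hl : (l : Multiset ℕ) = prof M G) :
    ((C2gen G.card (prof M G) : ℕ) : ℚ) = Table.C2 G.card l := by
  rw [← hl]
  exact C2gen_cast (by rw [hl]; exact prof_sum_choose_le hs hG)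

/-- The `Σ C(m, 2) ≤ C(g, 2)` hypothesis of p3's rows, in p3's spelling. -/
theorem ch_sum_le_of (l : List ℕ) {g : ℕ}
    (h : (Multiset.map (fun m => m.choose 2) (l : Multiset ℕ)).sum ≤ g.choose 2) :
    (l.map fun m => ((Table.ch m 2 : ℕ) : ℚ)).sum ≤ ((Table.ch g 2 : ℕ) : ℚ) := by
  have := (Nat.cast_le (α := ℚ)).2 h
  rw [cast_msum] at this
  simpa only [Table.ch_eq_choose] using this

/-! ### The shape lemmas: `Δ_t ≥ correction` from p3's rows -/

/-- **General planes** (every line misses `≥ 3` points): some list `l` represents the profile and `0 ≤ Δ_t(g, l)`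
(p3's rows `table_general_short_all` / `table_general_long_all`, using `prof_at_most_one_long`). -/
theorem exists_Δ_nonneg_general (hs : Simple M) {G : Finset α} (hG : G ∈ planes M) (hg4 : 4 ≤ G.card)
    (hgen : ∀ m ∈ prof M G, m + 3 ≤ G.card) {t : ℕ} (ht : t = 1 ∨ t = 2 ∨ t = 3) :
    ∃ l : List ℕ, (l : Multiset ℕ) = prof M G ∧ 0 ≤ Table.Δ t G.card l := by
  classical
  by_cases hlong : ∃ m₀ ∈ prof M G, (G.card + 1) / 2 < m₀
  · obtain ⟨m₀, hm₀, hm₀long⟩ := hlong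
    obtain ⟨l', hl'⟩ := Quotient.exists_rep ((prof M G).erase m₀)
    have hl'' : (l' : Multiset ℕ) = (prof M G).erase m₀ := hl'
    refine ⟨m₀ :: l', ?_, ?_⟩
    · rw [← Multiset.cons_coe, hl'', Multiset.cons_erase hm₀]
    · rw [Table.Δ_additive, List.map_cons, List.sum_cons, ← add_assoc]
      apply Table.table_general_long_all ht hg4 m₀ hm₀long (hgen m₀ hm₀) l'
      · intro m hm
        have hmP : m ∈ (prof M G).erase m₀ := by rw [← hl'']; exact Multiset.mem_coe.2 hm
        have hm3 := (prof_mem_bounds hG (Multiset.mem_of_mem_erase hmP)).1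
        refine ⟨hm3, ?_⟩
        by_contra hcon
        push Not at hcon
        have h1 := prof_at_most_one_long hs hG
        have hsplit : (prof M G).filter (fun m => G.card + 1 < 2 * m) =
            m₀ ::ₘ ((prof M G).erase m₀).filter (fun m => G.card + 1 < 2 * m) := by
          conv_lhs => rw [← Multiset.cons_erase hm₀]
          rw [Multiset.filter_cons_of_pos _ (by omega)]
        rw [hsplit, Multiset.card_cons] at h1
        have : 0 < Multiset.card (((prof M G).erase m₀).filter (fun m => G.card + 1 < 2 * m)) :=
          Multiset.card_pos_iff_exists_mem.2 ⟨m, Multiset.mem_filter.2 ⟨hmP, by omega⟩⟩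
        omega
      · have h2 := prof_sum_choose_le hs hG
        rw [← Multiset.cons_erase hm₀, Multiset.map_cons, Multiset.sum_cons, ← hl''] at h2
        have := (Nat.cast_le (α := ℚ)).2 h2
        rw [Nat.cast_add, cast_msum] at this
        simpa only [Table.ch_eq_choose] using this
  · push Not at hlong
    obtain ⟨l, hl⟩ := Quotient.exists_rep (prof M G)
    have hl' : (l : Multiset ℕ) = prof M G := hl
    refine ⟨l, hl', ?_⟩
    rw [Table.Δ_additive]
    apply Table.table_general_short_all ht hg4 l
    · intro m hm
      have hmP : m ∈ prof M G := mem_prof_of_mem_list hl' hm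
      exact ⟨(prof_mem_bounds hG hmP).1, hlong m hmP⟩
    · exact ch_sum_le_of l (by rw [hl']; exact prof_sum_choose_le hs hG)

/-- **Line + point** (`prof = {g − 1}`): `3·[t = 2] ≤ Δ_t(g, [g − 1])`. -/
theorem Δ_linePoint_ge {g t : ℕ} (ht : t = 1 ∨ t = 2 ∨ t = 3) (hg4 : 4 ≤ g) :
    (if t = 2 then (3 : ℚ) else 0) ≤ Table.Δ t g [g - 1] := by
  have h := Table.table_linePoint_all ht hg4
  rw [Table.Δ_additive, List.map_cons, List.map_nil, List.sum_cons, List.sum_nil, add_zero]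
  linarith

/-- **Two lines meeting in a point** (`prof = {m₁, m₂}`, `3 ≤ m₂ ≤ m₁`, `m₁ + m₂ = g + 1`): `12·[t = 3] ≤ Δ_t`. -/
theorem Δ_meet_ge {g t m₁ m₂ : ℕ} (ht : t = 1 ∨ t = 2 ∨ t = 3) (hg4 : 4 ≤ g) (h3 : 3 ≤ m₂) (hle : m₂ ≤ m₁)
    (hsum : m₁ + m₂ = g + 1) : (if t = 3 then (12 : ℚ) else 0) ≤ Table.Δ t g [m₁, m₂] := by
  have h := Table.table_twoLines_meet_all ht hg4 h3 hle hsum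
  rw [Table.Δ_additive]
  simp only [List.map_cons, List.map_nil, List.sum_cons, List.sum_nil, add_zero]
  linarith

/-- **Two disjoint lines** (`prof = {m₁, m₂}`, `3 ≤ m₂ ≤ m₁`, `m₁ + m₂ = g`): `6·[t = 3] ≤ Δ_t`. -/
theorem Δ_disj_ge {g t m₁ m₂ : ℕ} (ht : t = 1 ∨ t = 2 ∨ t = 3) (hg4 : 4 ≤ g) (h3 : 3 ≤ m₂) (hle : m₂ ≤ m₁)
    (hsum : m₁ + m₂ = g) : (if t = 3 then (6 : ℚ) else 0) ≤ Table.Δ t g [m₁, m₂] := by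
  have h := Table.table_twoLines_disj_all ht hg4 (by omega : 2 ≤ m₂) hle hsum
  rw [if_pos h3] at h
  rw [Table.Δ_additive]
  simp only [List.map_cons, List.map_nil, List.sum_cons, List.sum_nil, add_zero]
  linarith

/-- **A line and a disjoint `2`-point line** (`prof = {m₁}`, `m₁ + 2 = g`): `6·[t = 3] ≤ Δ_t(g, [m₁])`. -/
theorem Δ_disj2_ge {g t m₁ : ℕ} (ht : t = 1 ∨ t = 2 ∨ t = 3) (hg4 : 4 ≤ g) (hle : 2 ≤ m₁)
    (hsum : m₁ + 2 = g) : (if t = 3 then (6 : ℚ) else 0) ≤ Table.Δ t g [m₁] := by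
  have h := Table.table_twoLines_disj_all ht hg4 (m₁ := m₁) (m₂ := 2) le_rfl hle hsum
  rw [if_neg (by norm_num)] at h
  rw [Table.Δ_additive, List.map_cons, List.map_nil, List.sum_cons, List.sum_nil, add_zero]
  linarith

/-! ### The three discharges -/

/-- The demand at `t = 1`, `2`, `3` (the `match` in `Table.D`). -/
theorem D_one (g : ℕ) (l : List ℕ) : Table.D 1 g l = 3 * (Table.N3cnt g l - 1) := rfl
/-- See `D_one`. -/
theorem D_two (g : ℕ) (l : List ℕ) : Table.D 2 g l = 3 * (Table.N3cnt g l - 1 - g) := rfl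
/-- See `D_one`. -/
theorem D_three (g : ℕ) (l : List ℕ) : Table.D 3 g l = 3 * (Table.N3cnt g l - Table.C2 g l) := rfl

/-- Types `1` and `2` from `Δ₁ ≥ 0` and `Δ₂ ≥ 3·[g − 1 ∈ prof]` on a representing list. -/
theorem tableIneqAdd12_of_Δ (hs : Simple M) {G : Finset α} (hG : G ∈ planes M) {l : List ℕ}
    (hl : (l : Multiset ℕ) = prof M G) (h1 : 0 ≤ Table.Δ 1 G.card l)
    (h2 : (if G.card - 1 ∈ prof M G then (3 : ℚ) else 0) ≤ Table.Δ 2 G.card l) :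
    TableIneqAdd12 G.card (prof M G) := by
  classical
  unfold Table.Δ at h1 h2
  rw [F_eq_of_plane hs hG (Or.inl rfl) hl, D_one, ← N3_eq_of_plane hs hG hl] at h1
  rw [F_eq_of_plane hs hG (Or.inr (Or.inl rfl)) hl, D_two, ← N3_eq_of_plane hs hG hl] at h2
  refine ⟨by linarith, ?_⟩
  by_cases hmem : G.card - 1 ∈ prof M G
  · have hg1 : 1 ≤ G.card := by
      have := (prof_mem_bounds hG hmem).1
      omega
    rw [if_pos hmem] at h2 ⊢
    rw [Nat.cast_sub hg1, Nat.cast_one]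
    linarith
  · rw [if_neg hmem] at h2 ⊢
    rw [Nat.sub_zero]
    linarith

/-- **Types `1` and `2` on every plane with `g ≥ 5`** (p3's rows through the seam). -/
theorem tableIneqAdd12_of_plane (hs : Simple M) {G : Finset α} (hG : G ∈ planes M) (hg5 : 5 ≤ G.card) :
    TableIneqAdd12 G.card (prof M G) := by
  classical
  have hg4 : 4 ≤ G.card := by omega
  rcases prof_classify hs hG hg4 with hgen | hlp | ⟨-, h2 | h2⟩
  · obtain ⟨l₁, hl₁, hΔ₁⟩ := exists_Δ_nonneg_general hs hG hg4 hgen (t := 1) (Or.inl rfl)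
    obtain ⟨l₂, hl₂, hΔ₂⟩ := exists_Δ_nonneg_general hs hG hg4 hgen (t := 2) (Or.inr (Or.inl rfl))
    have hnot : G.card - 1 ∉ prof M G := fun h => by have := hgen _ h; omega
    -- both lists represent the profile; use `l₂` for both rows via `l₁ = l₂` as multisets
    have hl₁₂ : (l₁ : Multiset ℕ) = (l₂ : Multiset ℕ) := by rw [hl₁, hl₂]
    have hF : Table.F 1 G.card l₁ = Table.F 1 G.card l₂ := by
      rw [F_eq_of_plane hs hG (Or.inl rfl) hl₁, F_eq_of_plane hs hG (Or.inl rfl) hl₂]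
    have hN : Table.N3cnt G.card l₁ = Table.N3cnt G.card l₂ := by
      rw [← N3_eq_of_plane hs hG hl₁, ← N3_eq_of_plane hs hG hl₂]
    refine tableIneqAdd12_of_Δ hs hG hl₂ ?_ ?_
    · unfold Table.Δ at hΔ₁ ⊢
      rw [D_one] at hΔ₁ ⊢
      rw [← hF, ← hN]
      exact hΔ₁
    · rw [if_neg hnot]; exact hΔ₂
  · have hl : (([G.card - 1] : List ℕ) : Multiset ℕ) = prof M G := by rw [hlp]; rfl
    have hmem : G.card - 1 ∈ prof M G := by rw [hlp]; exact Multiset.mem_singleton_self _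
    refine tableIneqAdd12_of_Δ hs hG hl ?_ ?_
    · have h := Δ_linePoint_ge (t := 1) (Or.inl rfl) hg4
      rwa [if_neg (by norm_num)] at h
    · have h := Δ_linePoint_ge (t := 2) (Or.inr (Or.inl rfl)) hg4
      rw [if_pos rfl] at h
      rwa [if_pos hmem]
  · have hl : (([G.card - 2] : List ℕ) : Multiset ℕ) = prof M G := by rw [h2]; rfl
    have hnot : G.card - 1 ∉ prof M G := by
      rw [h2, Multiset.mem_singleton]; omega
    refine tableIneqAdd12_of_Δ hs hG hl ?_ ?_
    · have h := Δ_disj2_ge (t := 1) (Or.inl rfl) hg4 (m₁ := G.card - 2) (by omega) (by omega)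
      rwa [if_neg (by norm_num)] at h
    · have h := Δ_disj2_ge (t := 2) (Or.inr (Or.inl rfl)) hg4 (m₁ := G.card - 2) (by omega) (by omega)
      rw [if_neg (by norm_num)] at h
      rwa [if_neg hnot]
  · have hl : (([G.card - 2, 3] : List ℕ) : Multiset ℕ) = prof M G := by rw [h2]; rfl
    have hnot : G.card - 1 ∉ prof M G := by
      rw [h2, Multiset.insert_eq_cons, Multiset.mem_cons, Multiset.mem_singleton]; omega
    refine tableIneqAdd12_of_Δ hs hG hl ?_ ?_
    · have h := Δ_meet_ge (t := 1) (Or.inl rfl) hg4 (m₁ := G.card - 2) (m₂ := 3) le_rfl (by omega) (by omega)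
      rwa [if_neg (by norm_num)] at h
    · have h := Δ_meet_ge (t := 2) (Or.inr (Or.inl rfl)) hg4 (m₁ := G.card - 2) (m₂ := 3) le_rfl (by omega)
        (by omega)
      rw [if_neg (by norm_num)] at h
      rwa [if_neg hnot]

/-- **Type `3`, general planes** (every line `L` has `ρ(G ∖ L) = 3`): `3 (N₃ − C₂) ≤ FsumAdd 3`. -/
theorem type3_general_of_plane (hs : Simple M) {G : Finset α} (hG : G ∈ planes M) (hg5 : 5 ≤ G.card)
    (hgen' : ∀ L ∈ linesOf M G, M.eRk ((G \ L : Finset α) : Set α) = 3) :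
    3 * ((N3 G.card (prof M G) : ℚ) - C2gen G.card (prof M G)) ≤ FsumAdd 3 G.card (prof M G) := by
  have hgen : ∀ m ∈ prof M G, m + 3 ≤ G.card := by
    intro m hm
    unfold prof at hm
    rw [Multiset.mem_map] at hm
    obtain ⟨L, hL, rfl⟩ := hm
    rw [Finset.mem_val, Finset.mem_filter] at hL
    have h3 := three_le_card_of_eRk_eq_three (hgen' L hL.1)
    have h := Finset.card_sdiff_add_card_inter G L
    rw [Finset.inter_comm] at h
    omega
  obtain ⟨l, hl, hΔ⟩ := exists_Δ_nonneg_general hs hG (by omega) hgen (t := 3) (Or.inr (Or.inr rfl))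
  unfold Table.Δ at hΔ
  rw [F_eq_of_plane hs hG (Or.inr (Or.inr rfl)) hl, D_three, ← N3_eq_of_plane hs hG hl,
    ← C2gen_eq_of_plane hs hG hl] at hΔ
  linarith

/-- Two distinct lines share at most one point of `G`. -/
theorem card_inter_lines_le_one (hs : Simple M) {L₁ L₂ : Finset α} (h1 : L₁ ∈ lines M) (h2 : L₂ ∈ lines M)
    (hne : L₁ ≠ L₂) (G : Finset α) : (L₁ ∩ L₂ ∩ G).card ≤ 1 := by
  by_contra h
  push Not at h
  obtain ⟨a, ha, b, hb, hab⟩ := Finset.one_lt_card.1 h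
  simp only [Finset.mem_inter] at ha hb
  exact hne (lines_eq_of_two_mem hs h1 h2 ha.1.1 hb.1.1 ha.1.2 hb.1.2 hab)

/-- The two-line discharge with the larger line first. -/
theorem type3_twoLines_aux (hs : Simple M) {G : Finset α} (hG : G ∈ planes M) (hg5 : 5 ≤ G.card)
    (L₁ L₂ : Finset α) (h12 : TwoLines M G L₁ L₂) (hnl : ∀ L ∈ linesOf M G, (L ∩ G).card + 2 ≤ G.card)
    (hle : (L₂ ∩ G).card ≤ (L₁ ∩ G).card) :
    3 * ((N3 G.card (prof M G) : ℚ) - C2gen G.card (prof M G) + 2 * 2 ^ (L₁ ∩ L₂ ∩ G).card) ≤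
      FsumAdd 3 G.card (prof M G) := by
  classical
  have hg4 : 4 ≤ G.card := by omega
  have hc : (L₁ ∩ L₂ ∩ G).card ≤ 1 :=
    card_inter_lines_le_one hs (Finset.mem_filter.1 h12.1).1 (Finset.mem_filter.1 h12.2.1).1 h12.2.2.1 G
  have hcard := card_eq_of_twoLines h12
  have hm1 : 3 ≤ (L₁ ∩ G).card := by omega
  have hm1' := hnl L₁ h12.1
  rcases prof_of_twoLines hs h12 hm1 with ⟨hm2, hP⟩ | ⟨hm2, hP⟩
  · have hl : (([(L₁ ∩ G).card, (L₂ ∩ G).card] : List ℕ) : Multiset ℕ) = prof M G := by rw [hP]; rfl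
    rcases Nat.le_one_iff_eq_zero_or_eq_one.1 hc with hc0 | hc1
    · have h := Δ_disj_ge (t := 3) (Or.inr (Or.inr rfl)) hg4 hm2 hle (by omega)
      rw [if_pos rfl] at h
      unfold Table.Δ at h
      rw [F_eq_of_plane hs hG (Or.inr (Or.inr rfl)) hl, D_three, ← N3_eq_of_plane hs hG hl,
        ← C2gen_eq_of_plane hs hG hl] at h
      rw [hc0, pow_zero]
      linarith
    · have h := Δ_meet_ge (t := 3) (Or.inr (Or.inr rfl)) hg4 hm2 hle (by omega)
      rw [if_pos rfl] at h
      unfold Table.Δ at h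
      rw [F_eq_of_plane hs hG (Or.inr (Or.inr rfl)) hl, D_three, ← N3_eq_of_plane hs hG hl,
        ← C2gen_eq_of_plane hs hG hl] at h
      rw [hc1, pow_one]
      linarith
  · have hc0 : (L₁ ∩ L₂ ∩ G).card = 0 := by omega
    have hl : (([(L₁ ∩ G).card] : List ℕ) : Multiset ℕ) = prof M G := by rw [hP]; rfl
    have h := Δ_disj2_ge (t := 3) (Or.inr (Or.inr rfl)) hg4 (m₁ := (L₁ ∩ G).card) (by omega) (by omega)
    rw [if_pos rfl] at h
    unfold Table.Δ at h
    rw [F_eq_of_plane hs hG (Or.inr (Or.inr rfl)) hl, D_three, ← N3_eq_of_plane hs hG hl,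
      ← C2gen_eq_of_plane hs hG hl] at h
    rw [hc0, pow_zero]
    linarith

/-- **Type `3`, two-line planes**: `3 (N₃ − C₂ + 2 · 2^{|L₁ ∩ L₂ ∩ G|}) ≤ FsumAdd 3`. -/
theorem type3_twoLines_of_plane (hs : Simple M) {G : Finset α} (hG : G ∈ planes M) (hg5 : 5 ≤ G.card)
    (L₁ L₂ : Finset α) (h12 : TwoLines M G L₁ L₂) (hnl : ∀ L ∈ linesOf M G, (L ∩ G).card + 2 ≤ G.card) :
    3 * ((N3 G.card (prof M G) : ℚ) - C2gen G.card (prof M G) + 2 * 2 ^ (L₁ ∩ L₂ ∩ G).card) ≤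
      FsumAdd 3 G.card (prof M G) := by
  rcases le_total (L₂ ∩ G).card (L₁ ∩ G).card with hle | hle
  · exact type3_twoLines_aux hs hG hg5 L₁ L₂ h12 hnl hle
  · have h21 : TwoLines M G L₂ L₁ :=
      ⟨h12.2.1, h12.1, h12.2.2.1.symm, by rw [Finset.union_comm]; exact h12.2.2.2⟩
    have h := type3_twoLines_aux hs hG hg5 L₂ L₁ h21 hnl hle
    rwa [Finset.inter_comm L₂ L₁] at h

end SixThree

end PercRepro
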